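import Summits.CriticalPhenomena.PercolationContinuityZ3.Theorems.PercNearOneGluingNoHeavyLowerTailAntitheticApexConeInvariance
import HarnessLib

/-!
# `NoHeavyLowerTail` (stmt-CriticalPhenomena-4575) — antithetic cluster pairs: the zone system of THEOREM K — part 4: INVARIANCE
# (zones and colours of a member of a part are those of its generator; prim-hp-2 gen 37, MEMO-gen37 §2)

Support file (`--supports stmt-CriticalPhenomena-4575`, hull-port prover `prim-hp-2`, gen 37).  No definitions, no named facts, no sorries;
standard axioms.  Setting and rule: `…AntitheticApexConeZones`; tools: `…AntitheticApexConeInvariance`.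

INVARIANCE (`ACone.invariance`, hypothesis (invariance) of `zoneSystem_bic_nonneg`): `T, M` in the constraint set, `M` agreeing with `T`
or with `Tᶜ` on every zone block of `T`.  Then for every `r ∈ R` the zone of `r` in `M` is its zone in `T`, with the same colour if `M`
agrees with `T` on the block and the opposite colour if it agrees with `Tᶜ`.  Cases (for agreement with `T`; agreement with `Tᶜ` is the
case `(T, Mᶜ)`): `r` red-reached in `T` (`ACone.inv_red`: standard-zone invariance, and if `r` became unreached its zone was `{r}` and no
swallowing appears); blue-reached (the case `(Tᶜ, Mᶜ)`); unreached and swallowed (`ACone.inv_sw`: the swallower's zone is invariant and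
still swallows `r`); unreached and not swallowed (`ACone.inv_small`: the star stays monochromatic; if `r` becomes reached its opposite
cluster is `{r}`, otherwise no swallowing appears).
[cite: VandenbergHaggstromKahn2005, §1 p. 3 (open cluster `C_s`)]
-/

noncomputable section

namespace Summit.CriticalPhenomena.PercolationContinuityZ3.Theorems

open Literature.Probability.Percolation
open scoped Classical symmDiff

namespace Antithetic

namespace ACone

section Invariance

variable {V : Type*} {E : Set (Sym2 V)} {s : V} {R : Set V} {T M : Set (Sym2 V)}

/-- **Invariance for a red-reached vertex** (agreement with `T` on its block). [this work] -/
theorem inv_red (hkey : ∀ (T : Set (Sym2 V)) (x : V), ¬ (openGraph (T ∩ E)).Reachable s x → ¬ (openGraph (Tᶜ ∩ E)).Reachable s x →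
      (∀ u, s(x, u) ∈ E → u ≠ x → s(x, u) ∈ T) ∨ (∀ u, s(x, u) ∈ E → u ≠ x → s(x, u) ∉ T))
    (hT : ∀ r ∈ R, ¬ ((openGraph (T ∩ E)).Reachable s r ∧ (openGraph (Tᶜ ∩ E)).Reachable s r))
    (hM : ∀ r ∈ R, ¬ ((openGraph (M ∩ E)).Reachable s r ∧ (openGraph (Mᶜ ∩ E)).Reachable s r))
    (hag : ∀ u ∈ R, (∀ e ∈ ZoneSys.blk E (zone E s R T u), (e ∈ M ↔ e ∈ T)) ∨
      (∀ e ∈ ZoneSys.blk E (zone E s R T u), (e ∈ M ↔ e ∉ T)))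
    {r : V} (hrR : r ∈ R) (hq : (openGraph (T ∩ E)).Reachable s r)
    (hagr : ∀ e ∈ ZoneSys.blk E (zone E s R T r), (e ∈ M ↔ e ∈ T)) :
    zone E s R M r = zone E s R T r ∧ r ∈ beta E s R M := by
  obtain ⟨-, hnb, hz, hreach⟩ := std_core (R := R) hkey (hT r hrR) (hM r hrR) hq hagr
  by_cases hrM : (openGraph (M ∩ E)).Reachable s r
  · exact ⟨hz hrM, beta_of_red hrM⟩
  · have hall : ∀ z ∈ zone E s R T r, z = r := fun z hz' => by_contra fun hzr => hrM (hreach ⟨z, hz', hzr⟩)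
    have hZT : zone E s R T r = {r} := Set.eq_singleton_iff_unique_mem.2 ⟨mem_zone_self, hall⟩
    have hZ' : zone E s R T r = openCluster (Tᶜ ∩ E) r := zone_of_red (hT r hrR) hq
    have hmT : ∀ u, s(r, u) ∈ E → u ≠ r → s(r, u) ∈ T := fun u hu hur => by
      by_contra h
      have : u ∈ zone E s R T r := by
        rw [hZ']
        exact ((openGraph_adj (Tᶜ ∩ E) r u).2 ⟨⟨h, hu⟩, hur.symm⟩).reachable
      exact hur (hall u this)
    have hmM : ∀ u, s(r, u) ∈ E → u ≠ r → s(r, u) ∈ M := fun u hu hur =>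
      (hagr _ (ZoneSys.mk_mem_blk hu hur.symm (Or.inl mem_zone_self))).2 (hmT u hu hur)
    have hrs : r ≠ s := ne_source_of_constraint (hT r hrR)
    obtain ⟨u₀, hu₀, hu₀r⟩ := Apex.exists_adj_of_reachable hrs hq
    have hredM : r ∈ hasRed E M := ⟨u₀, hu₀.2, hu₀r, hmM u₀ hu₀.2 hu₀r⟩
    have HZ : ∀ q ∈ R, ((openGraph (T ∩ E)).Reachable s q ∨ (openGraph (Tᶜ ∩ E)).Reachable s q) →
        r ∈ zone E s R T q → q = r := by
      intro q hqR hqT hrz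
      rcases hqT with hqr | hqb
      · rw [zone_of_red (hT q hqR) hqr] at hrz
        have : q ∈ zone E s R T r := by
          rw [hZ']
          exact (show (openGraph (Tᶜ ∩ E)).Reachable q r from hrz).symm
        exact hall q this
      · rw [zone_of_blue (hT q hqR) hqb] at hrz
        exact absurd hq (not_reachable_of_mem_openCluster _ hrz fun h => hT q hqR ⟨h, hqb⟩)
    have hsw : r ∉ sw E s R M := not_sw_of_unreached hkey hT hM hag hrM hnb hZT HZ
    refine ⟨by rw [zone_of_small hrM hnb hsw, hZT], ?_⟩
    rw [beta_iff_of_none hrM hnb]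
    exact iff_of_false hsw (not_not.2 hredM)

/-- **Invariance for a swallowed vertex with a red-reached swallower** (agreement with `T` on its block). [this work] -/
theorem inv_sw_red (hkey : ∀ (T : Set (Sym2 V)) (x : V), ¬ (openGraph (T ∩ E)).Reachable s x → ¬ (openGraph (Tᶜ ∩ E)).Reachable s x →
      (∀ u, s(x, u) ∈ E → u ≠ x → s(x, u) ∈ T) ∨ (∀ u, s(x, u) ∈ E → u ≠ x → s(x, u) ∉ T))
    (hT : ∀ r ∈ R, ¬ ((openGraph (T ∩ E)).Reachable s r ∧ (openGraph (Tᶜ ∩ E)).Reachable s r))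
    (hM : ∀ r ∈ R, ¬ ((openGraph (M ∩ E)).Reachable s r ∧ (openGraph (Mᶜ ∩ E)).Reachable s r))
    {r : V} (hr : ¬ (openGraph (T ∩ E)).Reachable s r) (hb : ¬ (openGraph (Tᶜ ∩ E)).Reachable s r) (hsw : r ∈ sw E s R T)
    {q₀ : V} (hq₀R : q₀ ∈ R) (hq₀ : (openGraph (T ∩ E)).Reachable s q₀) (hq₀r : q₀ ≠ r)
    (hZ₀ : zone E s R T q₀ = zone E s R T r) (hrZ₀ : r ∈ zone E s R T q₀)
    (hagr : ∀ e ∈ ZoneSys.blk E (zone E s R T r), (e ∈ M ↔ e ∈ T)) :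
    zone E s R M r = zone E s R T r ∧ (r ∈ beta E s R M ↔ r ∈ beta E s R T) := by
  have hag₀ : ∀ e ∈ ZoneSys.blk E (zone E s R T q₀), (e ∈ M ↔ e ∈ T) := by rw [hZ₀]; exact hagr
  obtain ⟨hcl, hnb₀, -, hreach₀⟩ := std_core (R := R) hkey (hT q₀ hq₀R) (hM q₀ hq₀R) hq₀ hag₀
  have hq₀M : (openGraph (M ∩ E)).Reachable s q₀ := hreach₀ ⟨r, hrZ₀, hq₀r.symm⟩
  have hZT₀ : zone E s R T q₀ = openCluster (Tᶜ ∩ E) q₀ := zone_of_red (hT q₀ hq₀R) hq₀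
  have hrb : r ∈ openCluster (Tᶜ ∩ E) q₀ := by rw [← hZT₀]; exact hrZ₀
  obtain ⟨w, hw, hwr⟩ := Apex.exists_adj_of_reachable (η := Tᶜ ∩ E) hq₀r.symm
    (show (openGraph (Tᶜ ∩ E)).Reachable q₀ r from hrb)
  have hmT : ∀ u, s(r, u) ∈ E → u ≠ r → s(r, u) ∉ T := by
    rcases hkey _ _ hr hb with hm | hm
    · exact absurd (hm w hw.2 hwr) hw.1
    · exact hm
  have hmM : ∀ u, s(r, u) ∈ E → u ≠ r → s(r, u) ∉ M := fun u hu hur h =>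
    hmT u hu hur ((hagr _ (ZoneSys.mk_mem_blk hu hur.symm (Or.inl mem_zone_self))).1 h)
  have hrs : r ≠ s := ne_source_of_unreached hr
  have hrbM : r ∈ openCluster (Mᶜ ∩ E) q₀ := by rw [hcl]; exact hrb
  have hbM : ¬ (openGraph (Mᶜ ∩ E)).Reachable s r := not_reachable_of_mem_openCluster _ hrbM hnb₀
  have hrM : ¬ (openGraph (M ∩ E)).Reachable s r := not_red_of_allBlue hrs hmM
  have hswM : r ∈ sw E s R M :=
    ⟨q₀, hq₀R, Or.inl hq₀M, Or.inr (show (openGraph (Mᶜ ∩ E)).Reachable q₀ r from hrbM).symm⟩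
  refine ⟨?_, ?_⟩
  · rw [zone_of_sw hrM hbM hswM, big_of_allBlue hmM, openCluster_eq_of_mem _ hrbM, hcl, ← hZT₀, hZ₀]
  · rw [beta_iff_of_none hrM hbM, beta_iff_of_none hr hb]
    have h1 : r ∉ hasRed E M := fun ⟨u, hu, hur, huM⟩ => hmM u hu hur huM
    have h2 : r ∉ hasRed E T := fun ⟨u, hu, hur, huT⟩ => hmT u hu hur huT
    exact iff_of_true ((iff_true_left hswM).2 h1) ((iff_true_left hsw).2 h2)

/-- A swallowed unreached vertex has a non-loop edge. [this work] -/
theorem hasEdge_of_sw {r : V} (hr : ¬ (openGraph (T ∩ E)).Reachable s r) (hb : ¬ (openGraph (Tᶜ ∩ E)).Reachable s r)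
    (hsw : r ∈ sw E s R T) : ∃ u, s(r, u) ∈ E ∧ u ≠ r := by
  obtain ⟨q, -, -, hqb, hqr⟩ := sw_witness hr hb hsw
  rcases edge_of_mem_big hqb hqr with ⟨u, huE, hur, -, -⟩ | ⟨u, huE, hur, -, -⟩
  · exact ⟨u, huE, hur⟩
  · exact ⟨u, huE, hur⟩

/-- **Invariance for a swallowed vertex** (agreement with `T` on its block). [this work] -/
theorem inv_sw (hkey : ∀ (T : Set (Sym2 V)) (x : V), ¬ (openGraph (T ∩ E)).Reachable s x → ¬ (openGraph (Tᶜ ∩ E)).Reachable s x →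
      (∀ u, s(x, u) ∈ E → u ≠ x → s(x, u) ∈ T) ∨ (∀ u, s(x, u) ∈ E → u ≠ x → s(x, u) ∉ T))
    (hT : ∀ r ∈ R, ¬ ((openGraph (T ∩ E)).Reachable s r ∧ (openGraph (Tᶜ ∩ E)).Reachable s r))
    (hM : ∀ r ∈ R, ¬ ((openGraph (M ∩ E)).Reachable s r ∧ (openGraph (Mᶜ ∩ E)).Reachable s r))
    {r : V} (hrR : r ∈ R) (hr : ¬ (openGraph (T ∩ E)).Reachable s r) (hb : ¬ (openGraph (Tᶜ ∩ E)).Reachable s r)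
    (hsw : r ∈ sw E s R T) (hagr : ∀ e ∈ ZoneSys.blk E (zone E s R T r), (e ∈ M ↔ e ∈ T)) :
    zone E s R M r = zone E s R T r ∧ (r ∈ beta E s R M ↔ r ∈ beta E s R T) := by
  obtain ⟨q₀, hq₀R, hq₀T, hq₀r, hZ₀, hrZ₀⟩ := exists_swallower hkey hT hr hb hsw
  rcases hq₀T with hq₀ | hq₀
  · exact inv_sw_red hkey hT hM hr hb hsw hq₀R hq₀ hq₀r hZ₀ hrZ₀ hagr
  · -- blue swallower: the case `(Tᶜ, Mᶜ)`
    have hb' : ¬ (openGraph (Tᶜᶜ ∩ E)).Reachable s r := by rw [compl_compl]; exact hr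
    have hsw' : r ∈ sw E s R Tᶜ := by rw [sw_compl]; exact hsw
    have hZ₀' : zone E s R Tᶜ q₀ = zone E s R Tᶜ r := by rw [zone_compl, zone_compl]; exact hZ₀
    have hrZ₀' : r ∈ zone E s R Tᶜ q₀ := by rw [zone_compl]; exact hrZ₀
    have hagr' : ∀ e ∈ ZoneSys.blk E (zone E s R Tᶜ r), (e ∈ Mᶜ ↔ e ∈ Tᶜ) := by
      rw [zone_compl]; exact agree_compl_both hagr
    obtain ⟨hz, hβ⟩ := inv_sw_red (M := Mᶜ) hkey (constraint_compl hT) (constraint_compl hM) hb hb' hsw' hq₀R hq₀ hq₀r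
      hZ₀' hrZ₀' hagr'
    rw [zone_compl, zone_compl] at hz
    have hedge := hasEdge_of_sw hr hb hsw
    rw [beta_compl (hM r hrR) (hkey _ _) hedge, beta_compl (hT r hrR) (hkey _ _) hedge] at hβ
    exact ⟨hz, not_iff_not.1 hβ⟩

/-- **Invariance for an unreached, non-swallowed vertex** (agreement with `T` on its block). [this work] -/
theorem inv_small (hkey : ∀ (T : Set (Sym2 V)) (x : V), ¬ (openGraph (T ∩ E)).Reachable s x → ¬ (openGraph (Tᶜ ∩ E)).Reachable s x →
      (∀ u, s(x, u) ∈ E → u ≠ x → s(x, u) ∈ T) ∨ (∀ u, s(x, u) ∈ E → u ≠ x → s(x, u) ∉ T))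
    (hT : ∀ r ∈ R, ¬ ((openGraph (T ∩ E)).Reachable s r ∧ (openGraph (Tᶜ ∩ E)).Reachable s r))
    (hM : ∀ r ∈ R, ¬ ((openGraph (M ∩ E)).Reachable s r ∧ (openGraph (Mᶜ ∩ E)).Reachable s r))
    (hag : ∀ u ∈ R, (∀ e ∈ ZoneSys.blk E (zone E s R T u), (e ∈ M ↔ e ∈ T)) ∨
      (∀ e ∈ ZoneSys.blk E (zone E s R T u), (e ∈ M ↔ e ∉ T)))
    {r : V} (hrR : r ∈ R) (hr : ¬ (openGraph (T ∩ E)).Reachable s r) (hb : ¬ (openGraph (Tᶜ ∩ E)).Reachable s r)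
    (hsw : r ∉ sw E s R T) (hagr : ∀ e ∈ ZoneSys.blk E (zone E s R T r), (e ∈ M ↔ e ∈ T)) :
    zone E s R M r = zone E s R T r ∧ (r ∈ beta E s R M ↔ r ∈ beta E s R T) := by
  have hZT := zone_of_small hr hb hsw
  have hrs : r ≠ s := ne_source_of_unreached hr
  have hagE : ∀ u, s(r, u) ∈ E → u ≠ r → (s(r, u) ∈ M ↔ s(r, u) ∈ T) := fun u hu hur =>
    hagr _ (by rw [hZT]; exact ZoneSys.mk_mem_blk hu hur.symm (Or.inl rfl))
  have hredEq : r ∈ hasRed E M ↔ r ∈ hasRed E T :=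
    ⟨fun ⟨u, hu, hur, h⟩ => ⟨u, hu, hur, (hagE u hu hur).1 h⟩, fun ⟨u, hu, hur, h⟩ => ⟨u, hu, hur, (hagE u hu hur).2 h⟩⟩
  have hβT : r ∈ beta E s R T ↔ r ∈ hasRed E T := (beta_iff_of_none hr hb).trans ((iff_false_left hsw).trans not_not)
  rw [hZT, hβT]
  by_cases hrM : (openGraph (M ∩ E)).Reachable s r
  · -- red-reached in `M`: all edges red, the blue cluster is `{r}`
    obtain ⟨u₀, hu₀, hu₀r⟩ := Apex.exists_adj_of_reachable hrs hrM
    have hu₀T : s(r, u₀) ∈ T := (hagE u₀ hu₀.2 hu₀r).1 hu₀.1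
    have hmT : ∀ u, s(r, u) ∈ E → u ≠ r → s(r, u) ∈ T := by
      rcases hkey _ _ hr hb with hm | hm
      · exact hm
      · exact absurd hu₀T (hm u₀ hu₀.2 hu₀r)
    have hcl : openCluster (Mᶜ ∩ E) r = {r} := openCluster_eq_singleton _ fun u hu => by
      by_contra hur
      exact hu.1 ((hagE u hu.2 hur).2 (hmT u hu.2 hur))
    refine ⟨by rw [zone_of_red (hM r hrR) hrM, hcl], iff_of_true (beta_of_red hrM) ⟨u₀, hu₀.2, hu₀r, hu₀T⟩⟩
  · by_cases hbM : (openGraph (Mᶜ ∩ E)).Reachable s r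
    · -- blue-reached in `M`: all edges blue, the red cluster is `{r}`
      obtain ⟨u₀, hu₀, hu₀r⟩ := Apex.exists_adj_of_reachable hrs hbM
      have hu₀T : s(r, u₀) ∉ T := fun h => hu₀.1 ((hagE u₀ hu₀.2 hu₀r).2 h)
      have hmT : ∀ u, s(r, u) ∈ E → u ≠ r → s(r, u) ∉ T := by
        rcases hkey _ _ hr hb with hm | hm
        · exact absurd (hm u₀ hu₀.2 hu₀r) hu₀T
        · exact hm
      have hcl : openCluster (M ∩ E) r = {r} := openCluster_eq_singleton _ fun u hu => by
        by_contra hur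
        exact hmT u hu.2 hur ((hagE u hu.2 hur).1 hu.1)
      refine ⟨by rw [zone_of_blue (hM r hrR) hbM, hcl], iff_of_false (not_beta_of_blue (hM r hrR) hbM) ?_⟩
      exact fun ⟨u, hu, hur, huT⟩ => hmT u hu hur huT
    · -- unreached in `M`: no swallowing appears
      have HZ : ∀ q ∈ R, ((openGraph (T ∩ E)).Reachable s q ∨ (openGraph (Tᶜ ∩ E)).Reachable s q) →
          r ∈ zone E s R T q → q = r :=
        fun q hqR hqT hrz => (hsw ⟨q, hqR, hqT, mem_big_comm (zone_subset_big hrz)⟩).elim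
      have hswM : r ∉ sw E s R M := not_sw_of_unreached hkey hT hM hag hrM hbM hZT HZ
      refine ⟨zone_of_small hrM hbM hswM, ?_⟩
      rw [beta_iff_of_none hrM hbM]
      exact ((iff_false_left hswM).trans not_not).trans hredEq

/-- **Invariance, agreement with `T`** (all types of `r`). [this work] -/
theorem inv_core (hkey : ∀ (T : Set (Sym2 V)) (x : V), ¬ (openGraph (T ∩ E)).Reachable s x → ¬ (openGraph (Tᶜ ∩ E)).Reachable s x →
      (∀ u, s(x, u) ∈ E → u ≠ x → s(x, u) ∈ T) ∨ (∀ u, s(x, u) ∈ E → u ≠ x → s(x, u) ∉ T))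
    (hT : ∀ r ∈ R, ¬ ((openGraph (T ∩ E)).Reachable s r ∧ (openGraph (Tᶜ ∩ E)).Reachable s r))
    (hM : ∀ r ∈ R, ¬ ((openGraph (M ∩ E)).Reachable s r ∧ (openGraph (Mᶜ ∩ E)).Reachable s r))
    (hag : ∀ u ∈ R, (∀ e ∈ ZoneSys.blk E (zone E s R T u), (e ∈ M ↔ e ∈ T)) ∨
      (∀ e ∈ ZoneSys.blk E (zone E s R T u), (e ∈ M ↔ e ∉ T)))
    {r : V} (hrR : r ∈ R) (hagr : ∀ e ∈ ZoneSys.blk E (zone E s R T r), (e ∈ M ↔ e ∈ T)) :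
    zone E s R M r = zone E s R T r ∧ (r ∈ beta E s R M ↔ r ∈ beta E s R T) := by
  by_cases hr : (openGraph (T ∩ E)).Reachable s r
  · obtain ⟨hz, hβ⟩ := inv_red hkey hT hM hag hrR hr hagr
    exact ⟨hz, iff_of_true hβ (beta_of_red hr)⟩
  · by_cases hb : (openGraph (Tᶜ ∩ E)).Reachable s r
    · -- blue-reached: the case `(Tᶜ, Mᶜ)`
      have hagr' : ∀ e ∈ ZoneSys.blk E (zone E s R Tᶜ r), (e ∈ Mᶜ ↔ e ∈ Tᶜ) := by
        rw [zone_compl]; exact agree_compl_both hagr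
      obtain ⟨hz, hβ⟩ := inv_red (T := Tᶜ) (M := Mᶜ) hkey (constraint_compl hT) (constraint_compl hM) (agree_all_compl hag)
        hrR hb hagr'
      rw [zone_compl, zone_compl] at hz
      obtain ⟨u, hu, hur⟩ := Apex.exists_adj_of_reachable (ne_source_of_constraint (hT r hrR)) hb
      have hedge : ∃ u, s(r, u) ∈ E ∧ u ≠ r := ⟨u, hu.2, hur⟩
      rw [beta_compl (hM r hrR) (hkey _ _) hedge] at hβ
      exact ⟨hz, iff_of_false hβ (not_beta_of_blue (hT r hrR) hb)⟩
    · by_cases hsw : r ∈ sw E s R T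
      · exact inv_sw hkey hT hM hrR hr hb hsw hagr
      · exact inv_small hkey hT hM hag hrR hr hb hsw hagr

/-- **Invariance of the zone system** (hypothesis (invariance) of `zoneSystem_bic_nonneg`): for `T, M` in the constraint set with `M`
agreeing with `T` or with `Tᶜ` on every zone block of `T`, every zone of `M` is the corresponding zone of `T`, with the same colour where
`M` agrees with `T` on the block and the opposite colour where it agrees with `Tᶜ`. [this work] -/
theorem invariance (hkey : ∀ (T : Set (Sym2 V)) (x : V), ¬ (openGraph (T ∩ E)).Reachable s x → ¬ (openGraph (Tᶜ ∩ E)).Reachable s x →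
      (∀ u, s(x, u) ∈ E → u ≠ x → s(x, u) ∈ T) ∨ (∀ u, s(x, u) ∈ E → u ≠ x → s(x, u) ∉ T))
    (hT : ∀ r ∈ R, ¬ ((openGraph (T ∩ E)).Reachable s r ∧ (openGraph (Tᶜ ∩ E)).Reachable s r))
    (hM : ∀ r ∈ R, ¬ ((openGraph (M ∩ E)).Reachable s r ∧ (openGraph (Mᶜ ∩ E)).Reachable s r))
    (hag : ∀ u ∈ R, (∀ e ∈ ZoneSys.blk E (zone E s R T u), (e ∈ M ↔ e ∈ T)) ∨
      (∀ e ∈ ZoneSys.blk E (zone E s R T u), (e ∈ M ↔ e ∉ T))) :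
    ∀ u ∈ R, zone E s R M u = zone E s R T u ∧
      (((∀ e ∈ ZoneSys.blk E (zone E s R T u), (e ∈ M ↔ e ∈ T)) ∧ (u ∈ beta E s R M ↔ u ∈ beta E s R T)) ∨
        ((∀ e ∈ ZoneSys.blk E (zone E s R T u), (e ∈ M ↔ e ∉ T)) ∧ (u ∈ beta E s R M ↔ u ∉ beta E s R T))) := by
  intro u hu
  by_cases hne : ∃ e, e ∈ ZoneSys.blk E (zone E s R T u)
  · rcases hag u hu with h | h
    · obtain ⟨hz, hβ⟩ := inv_core hkey hT hM hag hu h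
      exact ⟨hz, Or.inl ⟨h, hβ⟩⟩
    · -- agreement with `Tᶜ`: the case `(T, Mᶜ)`
      obtain ⟨hz, hβ⟩ := inv_core (M := Mᶜ) hkey hT (constraint_compl hM) (agree_all_compl_right hag) hu (agree_compl_left h)
      rw [zone_compl] at hz
      obtain ⟨e, he⟩ := hne
      have hedge := hasEdge_of_mem_blk (hT u hu) he
      rw [beta_compl (hM u hu) (hkey _ _) hedge] at hβ
      exact ⟨hz, Or.inr ⟨h, by rw [← hβ, not_not]⟩⟩
  · -- empty block: `M` agrees with `T` vacuously
    have h : ∀ e ∈ ZoneSys.blk E (zone E s R T u), (e ∈ M ↔ e ∈ T) := fun e he => (hne ⟨e, he⟩).elim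
    obtain ⟨hz, hβ⟩ := inv_core hkey hT hM hag hu h
    exact ⟨hz, Or.inl ⟨h, hβ⟩⟩

end Invariance

end ACone

end Antithetic

end Summit.CriticalPhenomena.PercolationContinuityZ3.Theorems
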